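import Mathlib
import Summits.KontsevichZagierPeriods.KontsevichZagierPeriods.Theorems.SoloInformedKummerHeumanMoves
import Summits.KontsevichZagierPeriods.KontsevichZagierPeriods.Theorems.SoloInformedKummerZeta
import Summits.KontsevichZagierPeriods.KontsevichZagierPeriods.Theorems.SoloInformedLegendreRelation
import Summits.KontsevichZagierPeriods.KontsevichZagierPeriods.Theorems.SoloInformedKummerInvolution
import HarnessLib
import HarnessLib.Audit

/-!
# Kummer family V: THEOREM XXVIII(b) — the circular reciprocity law for `Π(n|m)` in `P` (s41)

Fifth and last file of THEOREM XXVIII(b) of the residency paper (§6quattuordecies; files I–IV =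
`SoloInformedKummerHeumanKernel`, `…Profile`, `…Band`, `…Moves`).  For a real algebraic squared
modulus `0 < m < 1` and a real algebraic amplitude `0 < s < 1` put `n = 1 − (1−m)s²` (so
`m < n < 1`: the CIRCULAR band of pole parameters of the Kummer family), `κ = ((1−x²)(1−mx²))^{-1/2}`,
`e = (1−mx²)κ`, `κ' = ((1−x²)(1−(1−m)x²))^{-1/2}`, `e' = (1−(1−m)x²)κ'`, and let

  `Π_n = [(0,1), κ/(1−nx²)]`, `K = [(0,1), κ]`, `E = [(0,1), e]`, `F♭ = [(0,s), κ']`, `E♭ = [(0,s), e']`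

(complete integrals of the third, first and second kind of modulus `m`; incomplete integrals of
the first and second kind of the COMPLEMENTARY modulus at amplitude `sin θ = s`).  THEOREM
(`soloInformed_kummer_heuman`): in the formal period ring `P` of the Kontsevich–Zagier calculus

  `2·⟦[pt, c]⟧·(⟦Π_n⟧ − ⟦K⟧) + 2·(⟦E⟧⟦F♭⟧ + ⟦K⟧⟦E♭⟧ − ⟦K⟧⟦F♭⟧) = ⟦[disc, 1]⟧`,
  `c = (1−m)s√(1−s²)/√(1−(1−m)s²)`,

the real form of the reciprocity law in the circular case (in values: Abramowitz–Stegun 17.7.14,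
`Π(n|m) = K + (π/2)δ₂(1 − Λ₀(θ\α))` with `δ₂ = 1/c` and Heuman's
`Λ₀ = (2/π)(E·F(θ|1−m) + K·E(θ|1−m) − K·F(θ|1−m))`).  Unlike the hyperbolic law of
`SoloInformedKummerZeta` this one is NOT `π`-free: its proof runs through Legendre's relation
(THEOREM XVII).  PROOF, inside the calculus: subtract the deformation from the kill of file IV,
insert the certificate `Sκκ' = Rκκ' + eκ' − κκ' + κe'` of file I (rule 1b), recognise the three
Fubini products `E × K'|(s,1)`, `K × K'|(s,1)`, `K × E'|(s,1)` (rule 1b), split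
`⟦K'⟧ = ⟦F♭⟧ + ⟦K'|(s,1)⟧`, `⟦E'⟧ = ⟦E♭⟧ + ⟦E'|(s,1)⟧` (rules 1a, 2), identify the deformed end
`[(0,1), −Ψ(x,s)]` with `c·(⟦K⟧ − ⟦Π_n⟧)` (file II), and close with THEOREM XVII.  Corollaries:
the law in values and the existence of the five representations.

References: M. Abramowitz, I. Stegun, *Handbook of Mathematical Functions*, 17.4.39, 17.7.14;
M. Kontsevich, D. Zagier, *Periods* (2001), §1.2; this work (solo-informed s38, s41).
-/

noncomputable section

open MeasureTheory Set Filter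
open scoped Classical

open Literature.NumberTheory.Transcendental Literature.NumberTheory.Transcendental.KZ
open Literature.ModelTheory.ExponentialFields

namespace Summit.KontsevichZagierPeriods.KontsevichZagierPeriods.Theorems

/-! ### Splitting an interval representation at an algebraic point -/

/-- For `r = [(0,1), f]`, `lo = [(0,c), f]` (`0 < c < 1` algebraic) there is `hi = [(c,1), f]`
with `⟦r⟧ = ⟦lo⟧ + ⟦hi⟧`: drop the null point `c` (rule 1a) and split (rule 2).
[cite: KontsevichZagier2001, §1.2] [this work] -/
theorem soloInformed_interval_split (r lo : IntegralRep 1) {c : ℝ} (hc : c ∈ Ioo (0:ℝ) 1)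
    (hca : IsAlgebraic ℚ c) (hrd : r.domain = {x | x 0 ∈ Ioo (0:ℝ) 1})
    (hlod : lo.domain = {x | x 0 ∈ Ioo (0:ℝ) c})
    (hloi : EqOn lo.integrand r.integrand lo.domain) :
    ∃ hi : IntegralRep 1, hi.domain = {x | x 0 ∈ Ioo c 1} ∧ hi.integrand = r.integrand ∧
      of r - of lo - of hi ∈ relations := by
  have hLo : IsSemialgebraic ℚ {x : Fin 1 → ℝ | x 0 ∈ Ioo (0:ℝ) c} :=
    (isSemialgebraic_setOf_const_lt_apply isAlgebraic_zero 0).inter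
      (isSemialgebraic_setOf_apply_lt_const hca 0)
  have hHi : IsSemialgebraic ℚ {x : Fin 1 → ℝ | x 0 ∈ Ioo c 1} :=
    (isSemialgebraic_setOf_const_lt_apply hca 0).inter
      (isSemialgebraic_setOf_apply_lt_const isAlgebraic_one 0)
  have hlo : {x : Fin 1 → ℝ | x 0 ∈ Ioo (0:ℝ) c} ⊆ r.domain := fun x hx => by
    rw [hrd]; exact ⟨hx.1, hx.2.trans hc.2⟩
  have hup : {x : Fin 1 → ℝ | x 0 ∈ Ioo c 1} ⊆ r.domain := fun x hx => by
    rw [hrd]; exact ⟨hc.1.trans hx.1, hx.2⟩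
  have hE : {x : Fin 1 → ℝ | x 0 ∈ Ioo (0:ℝ) c} ∪ {x : Fin 1 → ℝ | x 0 ∈ Ioo c 1} ⊆ r.domain :=
    union_subset hlo hup
  -- (i) dropping the point `c` costs nothing
  have hvol : volume (r.domain \ ({x : Fin 1 → ℝ | x 0 ∈ Ioo (0:ℝ) c} ∪
      {x : Fin 1 → ℝ | x 0 ∈ Ioo c 1})) = 0 := by
    refine measure_mono_null (fun x hx => ?_) (BallPeeling.volume_setOf_apply_eq_const 1 0 c)
    rw [hrd] at hx
    simp only [Set.mem_sdiff, mem_setOf_eq, mem_union, mem_Ioo, not_or, not_and, not_lt] at hx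
    obtain ⟨⟨h0, h1⟩, hlo', hup'⟩ := hx
    have h2 : c ≤ x 0 := hlo' h0
    have h3 : x 0 ≤ c := by
      by_contra h
      exact absurd (hup' (not_le.mp h)) (not_le.2 h1)
    show x 0 = c
    exact le_antisymm h3 h2
  have h1 := IntegralRep.of_sub_of_restrict_mem_relations r (hLo.union hHi) hE hvol
  -- (ii) the union splits (disjoint open slabs)
  have h2 : of (r.restrict _ (hLo.union hHi) hE) - of (r.restrict _ hLo hlo) -
      of (r.restrict _ hHi hup) ∈ relations := by
    refine domainAddRel_subset_relations ⟨1, r.restrict _ (hLo.union hHi) hE,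
      r.restrict _ hLo hlo, r.restrict _ hHi hup, rfl, ?_, fun _ _ => rfl, fun _ _ => rfl, rfl⟩
    rw [IntegralRep.domain_restrict, IntegralRep.domain_restrict]
    have : {x : Fin 1 → ℝ | x 0 ∈ Ioo (0:ℝ) c} ∩ {x : Fin 1 → ℝ | x 0 ∈ Ioo c 1} = ∅ := by
      ext x
      simp only [mem_inter_iff, mem_setOf_eq, mem_Ioo, mem_empty_iff_false, iff_false, not_and]
      exact fun h h' _ => by linarith [h.2, h']
    rw [this, measure_empty]
  -- (iii) `lo` is the lower slab of `r`
  have h3 : of lo - of (r.restrict _ hLo hlo) ∈ relations :=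
    of_sub_of_mem_relations_of_eqOn (by rw [IntegralRep.domain_restrict, hlod]) fun x hx => hloi hx
  refine ⟨r.restrict _ hHi hup, IntegralRep.domain_restrict _ _ _ _, rfl, ?_⟩
  have h := relations.sub_mem (relations.add_mem h1 h2) h3
  convert h using 1
  abel

/-! ### THEOREM XXVIII(b) -/

/-- **THEOREM XXVIII(b) (circular reciprocity law for the third kind).**  For real algebraic
`m, s ∈ (0,1)`, `n = 1 − (1−m)s²`, with `Π_n = [(0,1), κ/(1−nx²)]`, `K = [(0,1), κ]`,
`E = [(0,1), e]` (modulus `m`) and `F♭ = [(0,s), κ']`, `E♭ = [(0,s), e']` (modulus `1 − m`):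
`2⟦[pt, c]⟧(⟦Π_n⟧ − ⟦K⟧) + 2(⟦E⟧⟦F♭⟧ + ⟦K⟧⟦E♭⟧ − ⟦K⟧⟦F♭⟧) = ⟦[disc, 1]⟧` in `P`,
`c = (1−m)s√(1−s²)/√(1−(1−m)s²)` — Abramowitz–Stegun 17.7.14 (Heuman's Lambda function) inside
the Kontsevich–Zagier calculus. [this work] -/
theorem soloInformed_kummer_heuman (m s : ℝ) (hm : m ∈ Ioo (0:ℝ) 1) (hma : IsAlgebraic ℚ m)
    (hs : s ∈ Ioo (0:ℝ) 1) (hsa : IsAlgebraic ℚ s) (PN K E Fc Ec : IntegralRep 1)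
    (hPNd : PN.domain = {x | x 0 ∈ Ioo (0:ℝ) 1})
    (hPNi : EqOn PN.integrand (fun x => (1 - (1 - (1 - m) * s ^ 2) * x 0 ^ 2)⁻¹ *
      ((√(1 - x 0 ^ 2))⁻¹ * (√(1 - m * x 0 ^ 2))⁻¹)) PN.domain)
    (hKd : K.domain = {x | x 0 ∈ Ioo (0:ℝ) 1})
    (hKi : EqOn K.integrand (fun x => (√(1 - x 0 ^ 2))⁻¹ * (√(1 - m * x 0 ^ 2))⁻¹) K.domain)
    (hEd : E.domain = {x | x 0 ∈ Ioo (0:ℝ) 1})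
    (hEi : EqOn E.integrand (fun x => (1 - m * x 0 ^ 2) *
      ((√(1 - x 0 ^ 2))⁻¹ * (√(1 - m * x 0 ^ 2))⁻¹)) E.domain)
    (hFcd : Fc.domain = {x | x 0 ∈ Ioo (0:ℝ) s})
    (hFci : EqOn Fc.integrand
      (fun x => (√(1 - x 0 ^ 2))⁻¹ * (√(1 - (1 - m) * x 0 ^ 2))⁻¹) Fc.domain)
    (hEcd : Ec.domain = {x | x 0 ∈ Ioo (0:ℝ) s})
    (hEci : EqOn Ec.integrand (fun x => (1 - (1 - m) * x 0 ^ 2) *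
      ((√(1 - x 0 ^ 2))⁻¹ * (√(1 - (1 - m) * x 0 ^ 2))⁻¹)) Ec.domain) :
    2 * (toFormalPeriod (of (IntegralRep.unit.constMul
        ((1 - m) * s * √(1 - s ^ 2) / √(1 - (1 - m) * s ^ 2))
        (soloInformed_kummerHeuman_scalar_isAlgebraic hm hma hs hsa))) *
        (toFormalPeriod (of PN) - toFormalPeriod (of K))) +
      2 * (toFormalPeriod (of E) * toFormalPeriod (of Fc) +
        toFormalPeriod (of K) * toFormalPeriod (of Ec) -
        toFormalPeriod (of K) * toFormalPeriod (of Fc)) = toFormalPeriod (of KZ.piRep) := by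
  have hc := soloInformed_kummerHeuman_scalar_isAlgebraic hm hma hs hsa
  have hm' := soloInformed_kummerHeuman_compl hm
  have hma' : IsAlgebraic ℚ (1 - m) := isAlgebraic_one.sub hma
  -- the complete complementary integrals, split at `s`
  obtain ⟨K', hK'd, hK'i⟩ := soloInformed_exists_ellipticK_rep (1 - m) hm' hma'
  obtain ⟨E', hE'd, hE'i⟩ := soloInformed_exists_ellipticE_rep (1 - m) hm' hma'
  obtain ⟨hiK, hhiKd, hhiKi, hsplK⟩ := soloInformed_interval_split K' Fc hs hsa hK'd hFcd
    fun x hx => (hFci hx).trans (hK'i x).symm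
  obtain ⟨hiE, hhiEd, hhiEi, hsplE⟩ := soloInformed_interval_split E' Ec hs hsa hE'd hEcd
    fun x hx => (hEci hx).trans (hE'i x).symm
  -- the two moves
  obtain ⟨r', rd, hr'd, hr'i, hrdd, hrdi, hdef⟩ :=
    soloInformed_kummerHeuman_deformation m s hm hma hs hsa
  obtain ⟨T, hTd, hTi, hT⟩ := soloInformed_kummerHeuman_killed m s hm hma hs hsa
  -- Fubini: the three products on `(0,1) × (s,1)`
  obtain ⟨hP1d, hP1i⟩ := soloInformed_prod_interval E hiK (Ioo (0:ℝ) 1) (Ioo s 1)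
    (fun u => (1 - m * u ^ 2) * ((√(1 - u ^ 2))⁻¹ * (√(1 - m * u ^ 2))⁻¹))
    (fun u => (√(1 - u ^ 2))⁻¹ * (√(1 - (1 - m) * u ^ 2))⁻¹) hEd hhiKd
    (fun x hx => hEi hx) (fun x _ => by rw [hhiKi, hK'i])
  obtain ⟨hP2d, hP2i⟩ := soloInformed_prod_interval K hiK (Ioo (0:ℝ) 1) (Ioo s 1)
    (fun u => (√(1 - u ^ 2))⁻¹ * (√(1 - m * u ^ 2))⁻¹)
    (fun u => (√(1 - u ^ 2))⁻¹ * (√(1 - (1 - m) * u ^ 2))⁻¹) hKd hhiKd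
    (fun x hx => hKi hx) (fun x _ => by rw [hhiKi, hK'i])
  obtain ⟨hP3d, hP3i⟩ := soloInformed_prod_interval K hiE (Ioo (0:ℝ) 1) (Ioo s 1)
    (fun u => (√(1 - u ^ 2))⁻¹ * (√(1 - m * u ^ 2))⁻¹)
    (fun u => (1 - (1 - m) * u ^ 2) * ((√(1 - u ^ 2))⁻¹ * (√(1 - (1 - m) * u ^ 2))⁻¹)) hKd hhiEd
    (fun x hx => hKi hx) (fun x _ => by rw [hhiEi, hE'i])
  -- `Q = E×K'| − K×K'| + K×E'|` and `Q₂ = E×K'| + K×E'|` as single representations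
  have hO := T.isSemialgebraic_domain
  rw [hTd] at hO
  have h1sa := (E.prod hiK).isSemialgebraicFunOn_integrand
  have h2sa := (K.prod hiK).isSemialgebraicFunOn_integrand
  have h3sa := (K.prod hiE).isSemialgebraicFunOn_integrand
  have h1i := (E.prod hiK).integrableOn
  have h2i := (K.prod hiK).integrableOn
  have h3i := (K.prod hiE).integrableOn
  rw [hP1d] at h1sa h1i
  rw [hP2d] at h2sa h2i
  rw [hP3d] at h3sa h3i
  set Q : IntegralRep 2 := ⟨{z : Fin 2 → ℝ | z 0 ∈ Ioo (0:ℝ) 1 ∧ z 1 ∈ Ioo s 1},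
    fun z => (E.prod hiK).integrand z - (K.prod hiK).integrand z + (K.prod hiE).integrand z, hO,
    ((h1sa.sub_holds h2sa).add_holds h3sa).congr fun z _ => by
      simp only [Pi.add_apply, Pi.sub_apply],
    (h1i.sub h2i).add h3i⟩ with hQ
  set Q₂ : IntegralRep 2 := ⟨{z : Fin 2 → ℝ | z 0 ∈ Ioo (0:ℝ) 1 ∧ z 1 ∈ Ioo s 1},
    fun z => (E.prod hiK).integrand z + (K.prod hiE).integrand z, hO,
    (h1sa.add_holds h3sa).congr fun z _ => by simp only [Pi.add_apply], h1i.add h3i⟩ with hQ₂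
  -- rule 1b with the certificate: `T = r' + Q` as integrands
  have hrel1 : of T - of r' - of Q ∈ relations := by
    refine integrandAddRel_subset_relations ⟨2, T, r', Q, by rw [hr'd, hTd], by rw [hTd],
      fun z hz => ?_, rfl⟩
    rw [hTd] at hz
    have hz' : z 0 ∈ Ioo (0:ℝ) 1 ∧ z 1 ∈ Ioo s 1 := hz
    have hD : 1 - (1 - (1 - m) * z 1 ^ 2) * z 0 ^ 2 ≠ 0 :=
      (soloInformed_kummerHeuman_denom_pos (s := z 1) hm (by nlinarith [hz'.1.1, hz'.1.2])).ne'
    rw [Pi.add_apply, hTi, hr'i]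
    simp only [hQ, hP1i z hz', hP2i z hz', hP3i z hz']
    linear_combination soloInformed_kummerHeuman_certificate hD
  have hrel2 : of Q₂ - of (E.prod hiK) - of (K.prod hiE) ∈ relations := by
    refine integrandAddRel_subset_relations ⟨2, Q₂, E.prod hiK, K.prod hiE, by rw [hP1d],
      by rw [hP3d], fun z _ => ?_, rfl⟩
    simp only [Pi.add_apply, hQ₂]
  have hrel2' : of Q₂ - of Q - of (K.prod hiK) ∈ relations := by
    refine integrandAddRel_subset_relations ⟨2, Q₂, Q, K.prod hiK, rfl, by rw [hP2d],
      fun z _ => ?_, rfl⟩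
    simp only [Pi.add_apply, hQ₂, hQ]
    ring
  -- the deformed end `[(0,1), −Ψ(x,s)]` is `c·(K − Π_n)`
  have hB : IsSemialgebraic ℚ {x : Fin 1 → ℝ | x 0 ∈ Ioo (0:ℝ) 1} :=
    BallPeeling.isSemialgebraic_posIoo
  have hPNsa := PN.isSemialgebraicFunOn_integrand
  have hKsa := K.isSemialgebraicFunOn_integrand
  have hPNint := PN.integrableOn
  have hKint := K.integrableOn
  rw [hPNd] at hPNsa hPNint
  rw [hKd] at hKsa hKint
  set D₁ : IntegralRep 1 := ⟨{x : Fin 1 → ℝ | x 0 ∈ Ioo (0:ℝ) 1},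
    fun x => K.integrand x - PN.integrand x, hB,
    (hKsa.sub_holds hPNsa).congr fun x _ => by simp only [Pi.sub_apply], hKint.sub hPNint⟩
    with hD₁
  have hrel3 : of K - of PN - of D₁ ∈ relations := by
    refine integrandAddRel_subset_relations ⟨1, K, PN, D₁, by rw [hKd, hPNd], by rw [hKd],
      fun x _ => ?_, rfl⟩
    simp only [Pi.add_apply, hD₁]
    ring
  have hn : 1 - (1 - m) * s ^ 2 ≠ 0 :=
    (soloInformed_kummerZeta_radicands_pos hm' (b := s) (by nlinarith [hs.1, hs.2])).2.ne'
  have hrel4 : of rd - of (D₁.constMul _ hc) ∈ relations := by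
    refine of_sub_of_mem_relations_of_eqOn (by rw [IntegralRep.domain_constMul, hrdd])
      fun x hx => ?_
    rw [hrdd] at hx
    have hx' : x 0 ∈ Ioo (0:ℝ) 1 := hx
    have hxPN : x ∈ PN.domain := by rw [hPNd]; exact hx
    have hxK : x ∈ K.domain := by rw [hKd]; exact hx
    have hD : 1 - (1 - (1 - m) * s ^ 2) * x 0 ^ 2 ≠ 0 :=
      (soloInformed_kummerHeuman_denom_pos (s := s) hm (by nlinarith [hx'.1, hx'.2])).ne'
    simp only [hrdi, IntegralRep.integrand_constMul, hD₁, hPNi hxPN, hKi hxK]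
    rw [soloInformed_kummerHeumanPsi_end hn hD, ← soloInformed_kummerHeuman_scalar_eq hm hs]
    ring
  -- Legendre's relation (THEOREM XVII) for the pair of moduli `m`, `1 − m`
  have hL := soloInformed_legendre_relation m hm hma K K' E E' hKd hKi hK'd (fun x _ => hK'i x)
    hEd hEi hE'd (fun x _ => hE'i x)
  -- assemble in `P`
  have eT := toFormalPeriod_eq_zero_of_mem hT
  have e1 := toFormalPeriod_eq_zero_of_mem hrel1
  have e2 := toFormalPeriod_eq_zero_of_mem hrel2
  have e2' := toFormalPeriod_eq_zero_of_mem hrel2'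
  have e3 := toFormalPeriod_eq_zero_of_mem hrel3
  have e4 := toFormalPeriod_eq_zero_of_mem hrel4
  have edef := toFormalPeriod_eq_zero_of_mem hdef
  have eK := toFormalPeriod_eq_zero_of_mem hsplK
  have eE := toFormalPeriod_eq_zero_of_mem hsplE
  rw [map_sub, map_sub] at e1 e2 e2' e3 eK eE
  rw [map_sub] at e4 edef
  have eP1 := toFormalPeriod_of_mul_of E hiK
  have eP2 := toFormalPeriod_of_mul_of K hiK
  have eP3 := toFormalPeriod_of_mul_of K hiE
  have eC := toFormalPeriod_of_constMul _ hc D₁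
  linear_combination hL + (2 * toFormalPeriod (of K) - 2 * toFormalPeriod (of E)) * eK -
    2 * toFormalPeriod (of K) * eE - 2 * eP1 - 2 * eP3 + 2 * eP2 + 2 * e2 - 2 * e2' + 2 * e1 -
    2 * eT + 2 * edef + 2 * e4 + 2 * eC -
    2 * toFormalPeriod (of (IntegralRep.unit.constMul _ hc)) * e3

/-- **THEOREM XXVIII(b) in values** (Abramowitz–Stegun 17.7.14, `m < n < 1`): with
`n = 1 − (1−m)s²`, `c = (1−m)s√(1−s²)/√(1−(1−m)s²)` and `sin θ = s`,
`2c·(Π(n|m) − K(m)) + 2·(E(m)F(θ|1−m) + K(m)E(θ|1−m) − K(m)F(θ|1−m)) = π`. [this work] -/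
theorem soloInformed_kummer_heuman_value (m s : ℝ) (hm : m ∈ Ioo (0:ℝ) 1) (hma : IsAlgebraic ℚ m)
    (hs : s ∈ Ioo (0:ℝ) 1) (hsa : IsAlgebraic ℚ s) (PN K E Fc Ec : IntegralRep 1)
    (hPNd : PN.domain = {x | x 0 ∈ Ioo (0:ℝ) 1})
    (hPNi : EqOn PN.integrand (fun x => (1 - (1 - (1 - m) * s ^ 2) * x 0 ^ 2)⁻¹ *
      ((√(1 - x 0 ^ 2))⁻¹ * (√(1 - m * x 0 ^ 2))⁻¹)) PN.domain)
    (hKd : K.domain = {x | x 0 ∈ Ioo (0:ℝ) 1})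
    (hKi : EqOn K.integrand (fun x => (√(1 - x 0 ^ 2))⁻¹ * (√(1 - m * x 0 ^ 2))⁻¹) K.domain)
    (hEd : E.domain = {x | x 0 ∈ Ioo (0:ℝ) 1})
    (hEi : EqOn E.integrand (fun x => (1 - m * x 0 ^ 2) *
      ((√(1 - x 0 ^ 2))⁻¹ * (√(1 - m * x 0 ^ 2))⁻¹)) E.domain)
    (hFcd : Fc.domain = {x | x 0 ∈ Ioo (0:ℝ) s})
    (hFci : EqOn Fc.integrand
      (fun x => (√(1 - x 0 ^ 2))⁻¹ * (√(1 - (1 - m) * x 0 ^ 2))⁻¹) Fc.domain)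
    (hEcd : Ec.domain = {x | x 0 ∈ Ioo (0:ℝ) s})
    (hEci : EqOn Ec.integrand (fun x => (1 - (1 - m) * x 0 ^ 2) *
      ((√(1 - x 0 ^ 2))⁻¹ * (√(1 - (1 - m) * x 0 ^ 2))⁻¹)) Ec.domain) :
    2 * ((1 - m) * s * √(1 - s ^ 2) / √(1 - (1 - m) * s ^ 2) * (PN.value - K.value)) +
      2 * (E.value * Fc.value + K.value * Ec.value - K.value * Fc.value) = Real.pi := by
  have h := congrArg evalP (soloInformed_kummer_heuman m s hm hma hs hsa PN K E Fc Ec hPNd hPNi hKd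
    hKi hEd hEi hFcd hFci hEcd hEci)
  simpa only [map_mul, map_add, map_sub, map_ofNat, evalP_toFormalPeriod_of,
    IntegralRep.value_constMul, IntegralRep.value_unit, mul_one, KZ.piRep_value] using h

/-- **The five representations exist**, and satisfy the law. [this work] -/
theorem soloInformed_kummer_heuman_exists (m s : ℝ) (hm : m ∈ Ioo (0:ℝ) 1) (hma : IsAlgebraic ℚ m)
    (hs : s ∈ Ioo (0:ℝ) 1) (hsa : IsAlgebraic ℚ s) :
    ∃ PN K E Fc Ec : IntegralRep 1,
      PN.domain = {x | x 0 ∈ Ioo (0:ℝ) 1} ∧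
      (∀ x, PN.integrand x = (1 - (1 - (1 - m) * s ^ 2) * x 0 ^ 2)⁻¹ *
        ((√(1 - x 0 ^ 2))⁻¹ * (√(1 - m * x 0 ^ 2))⁻¹)) ∧
      K.domain = {x | x 0 ∈ Ioo (0:ℝ) 1} ∧
      (∀ x, K.integrand x = (√(1 - x 0 ^ 2))⁻¹ * (√(1 - m * x 0 ^ 2))⁻¹) ∧
      E.domain = {x | x 0 ∈ Ioo (0:ℝ) 1} ∧
      (∀ x, E.integrand x = (1 - m * x 0 ^ 2) * ((√(1 - x 0 ^ 2))⁻¹ * (√(1 - m * x 0 ^ 2))⁻¹)) ∧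
      Fc.domain = {x | x 0 ∈ Ioo (0:ℝ) s} ∧
      (∀ x, Fc.integrand x = (√(1 - x 0 ^ 2))⁻¹ * (√(1 - (1 - m) * x 0 ^ 2))⁻¹) ∧
      Ec.domain = {x | x 0 ∈ Ioo (0:ℝ) s} ∧
      (∀ x, Ec.integrand x = (1 - (1 - m) * x 0 ^ 2) *
        ((√(1 - x 0 ^ 2))⁻¹ * (√(1 - (1 - m) * x 0 ^ 2))⁻¹)) ∧
      2 * ((1 - m) * s * √(1 - s ^ 2) / √(1 - (1 - m) * s ^ 2) * (PN.value - K.value)) +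
        2 * (E.value * Fc.value + K.value * Ec.value - K.value * Fc.value) = Real.pi := by
  have hm' := soloInformed_kummerHeuman_compl hm
  have hma' : IsAlgebraic ℚ (1 - m) := isAlgebraic_one.sub hma
  have hn : 1 - (1 - m) * s ^ 2 < 1 := by nlinarith [mul_pos hm'.1 (pow_pos hs.1 2)]
  obtain ⟨PN, hPNd, hPNi⟩ := soloInformed_exists_ellipticPi_rep_of_lt_one (1 - (1 - m) * s ^ 2) m hn
    (isAlgebraic_one.sub (hma'.mul (hsa.pow 2))) hm hma
  obtain ⟨K, hKd, hKi⟩ := soloInformed_exists_ellipticK_rep m hm hma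
  obtain ⟨E, hEd, hEi⟩ := soloInformed_exists_ellipticE_rep m hm hma
  obtain ⟨K', hK'd, hK'i⟩ := soloInformed_exists_ellipticK_rep (1 - m) hm' hma'
  obtain ⟨E', hE'd, hE'i⟩ := soloInformed_exists_ellipticE_rep (1 - m) hm' hma'
  have hI : IsSemialgebraic ℚ {x : Fin 1 → ℝ | x 0 ∈ Ioo (0:ℝ) s} :=
    (isSemialgebraic_setOf_const_lt_apply isAlgebraic_zero 0).inter
      (isSemialgebraic_setOf_apply_lt_const hsa 0)
  have hIK : {x : Fin 1 → ℝ | x 0 ∈ Ioo (0:ℝ) s} ⊆ K'.domain := fun x hx => by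
    rw [hK'd]; exact ⟨hx.1, hx.2.trans hs.2⟩
  have hIE : {x : Fin 1 → ℝ | x 0 ∈ Ioo (0:ℝ) s} ⊆ E'.domain := fun x hx => by
    rw [hE'd]; exact ⟨hx.1, hx.2.trans hs.2⟩
  refine ⟨PN, K, E, K'.restrict _ hI hIK, E'.restrict _ hI hIE, hPNd, hPNi, hKd, hKi, hEd, hEi,
    rfl, fun x => by rw [IntegralRep.integrand_restrict, hK'i], rfl,
    fun x => by rw [IntegralRep.integrand_restrict, hE'i], ?_⟩
  exact soloInformed_kummer_heuman_value m s hm hma hs hsa PN K E _ _ hPNd (fun x _ => hPNi x)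
    hKd (fun x _ => hKi x) hEd (fun x _ => hEi x) rfl
    (fun x _ => by rw [IntegralRep.integrand_restrict, hK'i]) rfl
    (fun x _ => by rw [IntegralRep.integrand_restrict, hE'i])

end Summit.KontsevichZagierPeriods.KontsevichZagierPeriods.Theorems
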